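import Literature.AnabelianGeometry.SemiGraphs.StableReductionTowerNonVacuity
import HarnessLib

/-!
# [SemiAnbd] Ex. 5.6: a `StableReductionOrigin` with a NON-EMPTY stable-reduction-tower certificate
# (degenerate tower, modulo one arithmetic semi-graph of anabelioids with `π̂₁(A) = 1`)

Mochizuki, *Semi-graphs of anabelioids*, Publ. RIMS **42** (2006) [SemiAnbd], Example 5.6 p. 67
[cite: MochizukiSemiAnbd2006, Ex 5.6, p. 67].

PROOF-ONLY sequel (abc-iut cell, layer L3, NV lane; seat abc-iut-w6-d055; abc-iut-L3-lead (gen 5) α56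
split, abc-iut-L3-t7 (gen 5)'s offer 08:28Z) of `OriginCertificatesNonVacuity.lean` (p432071: the origin
certificates at the genuine `p`-adic model, where the tower certificate is necessarily EMPTY — FINDING (F):
Def. 5.1 (i)(a) at `π̂₁(A_i) ≅ aug(M_i)` open in `G_{ℚ_p}`) and of abc-iut-L3-t7's
`StableReductionTower.exists_of_arithSemiGraph` (p432568: over an algebraically closed base, `G_K = 1`, the
DEGENERATE constant tower exists as soon as ONE arithmetic semi-graph of anabelioids `𝔊` with `π̂₁(A) = 1` is
given — the deferred `ArithSemiGraph` producer).  Under that same single input, the PRINCIPAL certificate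
issuing `IsStableReductionTowerOf` exactly to t7's pair `(D, T)` and `IsOfGeometricOrigin` exactly to `D`
inhabits `StableReductionOrigin 𝓥 K` with a NON-EMPTY tower certificate; the axiom
`isOfGeometricOrigin_of_isStableReductionTowerOf` is discharged by a projection (non-vacuously), the Tate
certificate is empty.  HONEST: degenerate arithmetic (`G_K = 1`, `Π = 1`), constant tower — consistency
evidence for the typed Ex. 5.6 interface only; not the stable-reduction tower of a curve; typed ≠ proved; no
side taken on [IUTchIII] Cor. 3.12.
-/

noncomputable section

namespace Literature.AnabelianGeometry.SemiGraphs

open _root_.CategoryTheory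

universe u v w u'

/-- **`StableReductionOrigin` with a NON-EMPTY tower certificate** (modulo one `𝔊 : ArithSemiGraph 𝓥` with
`π̂₁(A) = 1`, over an algebraically closed base): the principal certificate at abc-iut-L3-t7's degenerate
tower `StableReductionTower.exists_of_arithSemiGraph`. [cite: MochizukiSemiAnbd2006, Ex 5.6, p. 67] -/
theorem StableReductionOrigin.exists_certifying_tower {Obj : Type u} [Category.{v} Obj]
    (𝓥 : SemiAnbdVocab.{u, v, w} Obj) (K : Type u') [Field K] [IsAlgClosed K] (𝔊 : ArithSemiGraph 𝓥)
    [Subsingleton (𝔊.PA : Type w)] :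
    ∃ (D : TemperedArithmeticGroup K) (T : StableReductionTower 𝓥 D) (Ω : StableReductionOrigin 𝓥 K),
      Ω.IsStableReductionTowerOf D T ∧ Ω.IsOfGeometricOrigin D ∧
      (∀ D' (T' : StableReductionTower 𝓥 D'), Ω.IsStableReductionTowerOf D' T' ↔
        (⟨D', T'⟩ : Σ A : TemperedArithmeticGroup K, StableReductionTower 𝓥 A) = ⟨D, T⟩) ∧
      (∀ A, Ω.IsOfGeometricOrigin A ↔ A = D) ∧ (∀ D', ¬ Ω.IsTateOrigin D') := by
  obtain ⟨D, ⟨T⟩⟩ := StableReductionTower.exists_of_arithSemiGraph (𝓥 := 𝓥) K 𝔊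
  refine ⟨D, T, ⟨⟨fun A => A = D, fun _ => False, fun _ h => h.elim⟩,
      fun D' T' => (⟨D', T'⟩ : Σ A : TemperedArithmeticGroup K, StableReductionTower 𝓥 A) = ⟨D, T⟩, ?_⟩,
    rfl, rfl, fun _ _ => Iff.rfl, fun _ => Iff.rfl, fun _ h => h⟩
  intro D' T' h
  exact congrArg Sigma.fst h

end Literature.AnabelianGeometry.SemiGraphs

end
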